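/-
Copyright (c) 2026 the pub-hodgecm-mathlib formalisation cell (harness21).  Prover seat hodgecm-mathlib-K2E3-p17 (g8), Track B «K2-LIT» ∕ h413
(`stmt-HodgeConjecture-24833`), line `K2_E3_EllipticInputs`, leaf (nsc-S-A′), D94 sub-brick S1b (GL2-LINKED, part (b)): the character `η∘det` inside the LINKED principal
series `I₂(ην^{-1∕2}, ην^{1∕2})` of `GL₂(F)`.  2026-09-04.
-/
import Summits.HodgeConjecture.HodgeConjecture.Theorems.K2E3GL2UnlinkedIrreducible      -- ★ GL2-UNL (K2E3-p11): `finrank_weightSpace_twist_det_two`, `normalizedJacquetGL_twist_det_two_mk`, `coe_unramifiedTwist_one`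
import Summits.HodgeConjecture.HodgeConjecture.Theorems.K2E3GL2JacquetRelabel           -- ★ E2-R′ (K2E3-p14): `finrank_weightSpace_id_eq_lastBlockLabel_two`; brings ★ `K2E3GL2BorelRelabelEquiv.exists_equiv_parabolicIndGL_id_lastBlockLabel_two`
import Summits.HodgeConjecture.HodgeConjecture.Theorems.K2E3GL3EmbeddingOfWeight         -- ★ EMB (this seat): `exists_injective_intertwiningMap_parabolicIndGL` (any `N`, `id`-labels)
import Summits.HodgeConjecture.HodgeConjecture.Theorems.K2E3GL3StandardModuleEmbedding  -- ★ STD-EMB (K2E3-p03): `coe_nuHalf_apply`, `normAbs_cpow_half_mul_self`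
import Literature.NumberTheory.Automorphic.GKModulesAdmissible                          -- ★ `isIrreducible_of_finrank_eq_one'`
import Literature.NumberTheory.Automorphic.SmoothCharacterOfCharacter                   -- ★ `isSmooth_trivial_twist`
import Literature.NumberTheory.Automorphic.InducedWhittakerVanishing                     -- ★ `whittakerChar_transvectionGL`, `transvectionGL_mem_upperUnitriangular`
import HarnessLib

/-!
# Crux `H413` — leaf (nsc-S-A′), sub-brick S1b (GL2-LINKED): `η∘det ↪ I₂(ην^{-1∕2}, ην^{1∕2})`, its weight, and its degeneracy

Cell `hodgecm-mathlib`, Track B; THEOREMS ONLY; count-neutral helper (`--supports stmt-HodgeConjecture-24833 --as helper`).  Currency: ★ G1∕PEEL∕GL2-UNL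
(`I₂ x y := parabolicIndGL F (lastBlockLabel 2) (𝟙.twist (maxParabolicLeviChar F 2 x y))`, `ρ_η := (trivial ℂ (GL (Fin 2) F) ℂ).twist (η ∘ det)`, `ν½ := (unramifiedTwist F (1/2)).toMonoidHom`,
`mult₂ V χ := finrank ℂ ↥(⨅ m, maxGenEigenspace (normalizedJacquetGL F (lastBlockLabel 2) V m) (χ m))`).

* §1 **`maxParabolicLeviChar_shift_eq_chi`**: `(ην½⁻¹) ⊠ (ην½) = χ_η := (η ⊠ η) · (δ^{1∕2} ∘ leviEmbeddingP)⁻¹` as characters of the diagonal torus — the exponent of `ρ_η` (★ GL2-UNL) IS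
  the inducing character of the linked principal series `I₂(ην½⁻¹, ην½)`.
* §2 `finrank_weightSpace_twist_det_two_shift` (`mult₂ ρ_η ((ην½⁻¹) ⊠ (ην½)) = 1`) and its `id`-labelled form (★ E2-R′ relabelling).
* §3 **`exists_injective_intertwiningMap_twist_det_principalSeries_two`**: an injective `GL₂`-map `ρ_η ↪ I₂(ην½⁻¹, ην½)` (★ EMB at `N = 2` + ★ relabelling equivalence);
  `ρ_η` is irreducible, smooth, NOT generic and `J_ψ(ρ_η) = 0` (`U₂` acts trivially).
Part (c) (`K2E3GL2LinkedJacquetRank`): proper non-zero subrepresentations of `I₂ x y` have a one-dimensional Jacquet module; the one with the weight `(ην½⁻¹) ⊠ (ην½)` is `ρ_η`.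

HONEST LABEL: HC_CM is proved only modulo the 7 printed citations (2 remaining named inputs: hLiu418 = stmt-HodgeConjecture-24832, h413 =
stmt-HodgeConjecture-24833) until rung 0 closes; count-neutral helper.

## References
* [BernsteinZelevinsky1977] I. N. Bernstein, A. V. Zelevinsky, *Induced representations of reductive p-adic groups I*, Ann. Sci. ÉNS 10 (1977), §2.3, 2.12, Thm. 2.5.
* [Zelevinsky1980] A. V. Zelevinsky, *Induced representations of reductive p-adic groups II*, Ann. Sci. ÉNS 13 (1980), §1.1, Ex. 3.2, Prop. 2.10.
* [Bump1997] D. Bump, *Automorphic forms and representations*, CUP 1997, §4.5, Thm. 4.5.1.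
-/

set_option autoImplicit false
-- the mandated namespace repeats `HodgeConjecture.HodgeConjecture`, as in every `Theorems/*.lean` of this sub-problem
set_option linter.dupNamespace false

noncomputable section

open Module Module.End Function Matrix
open scoped MatrixGroups NNReal
open Literature.NumberTheory.Automorphic Literature.NumberTheory.Automorphic.Zelevinsky1980 ValuativeRel
open Literature.NumberTheory.GaloisRepresentations Literature.NumberTheory.GaloisRepresentations.IsNonarchimedeanLocalField
open Summit.HodgeConjecture.HodgeConjecture.Cruxes.H413.K2E3GL2UnlinkedIrreducible (finrank_weightSpace_twist_det_two normalizedJacquetGL_twist_det_two_mk)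
open Summit.HodgeConjecture.HodgeConjecture.Cruxes.H413.K2E3GL2JacquetRelabel (finrank_weightSpace_id_eq_lastBlockLabel_two)
open Summit.HodgeConjecture.HodgeConjecture.Cruxes.H413.K2E3GL3EmbeddingOfWeight (exists_injective_intertwiningMap_parabolicIndGL)
open Summit.HodgeConjecture.HodgeConjecture.Cruxes.H413.K2E3GL3StandardModuleEmbedding (coe_nuHalf_apply normAbs_cpow_half_mul_self)

namespace Summit.HodgeConjecture.HodgeConjecture.Cruxes.H413.K2E3GL2LinkedStructure

variable {F : Type} [Field F] [ValuativeRel F] [TopologicalSpace F] [IsNonarchimedeanLocalField F] (η : Fˣ →* ℂˣ)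

/-! ## §1 The inducing character of `I₂(ην½⁻¹, ην½)` is the exponent `χ_η` of `η∘det` -/

/-- `‖x‖^{1∕2} ≠ 0` in `ℂ` for a unit `x`. [folklore] -/
theorem normAbs_cpow_half_ne_zero (x : Fˣ) : (((normAbs F (x : F) : ℝ≥0) : ℝ) : ℂ) ^ ((1 / 2 : ℂ)) ≠ 0 :=
  Complex.cpow_ne_zero_iff.2 (Or.inl (by exact_mod_cast normAbs_units_ne_zero x))

/-- The real `δ`-factor `‖d₀‖^{1∕2} ‖d₁‖^{(1-2)∕2}` of `Q_{1,1}` as a quotient of complex square roots. [cite: BernsteinZelevinsky1977, 1.7] -/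
theorem coe_rpow_half_mul_rpow_neg_half (d₀ d₁ : Fˣ) :
    ((((normAbs F (d₀ : F) : ℝ≥0) : ℝ) ^ (1 / 2 : ℝ) * ((normAbs F (d₁ : F) : ℝ≥0) : ℝ) ^ ((1 - (2 : ℝ)) / 2) : ℝ) : ℂ) =
      (((normAbs F (d₀ : F) : ℝ≥0) : ℝ) : ℂ) ^ ((1 / 2 : ℂ)) * ((((normAbs F (d₁ : F) : ℝ≥0) : ℝ) : ℂ) ^ ((1 / 2 : ℂ)))⁻¹ := by
  have h1 : ((1 - (2 : ℝ)) / 2 : ℝ) = -(1 / 2 : ℝ) := by norm_num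
  rw [h1, Real.rpow_neg (NNReal.coe_nonneg _), Complex.ofReal_mul, Complex.ofReal_inv, Complex.ofReal_cpow (NNReal.coe_nonneg _),
    Complex.ofReal_cpow (NNReal.coe_nonneg _)]
  norm_num

/-- **`(ην½⁻¹) ⊠ (ην½) = χ_η = (η ⊠ η) · (δ_Q^{1∕2} ∘ leviEmbeddingP)⁻¹`** as characters of the diagonal torus of `GL₂(F)`: the exponent of `η ∘ det` (★ GL2-UNL) is the inducing
character of the linked principal series. [cite: Zelevinsky1980, Ex. 3.2] [cite: Bump1997, Thm. 4.5.1] -/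
theorem maxParabolicLeviChar_shift_eq_chi :
    maxParabolicLeviChar F 2 (η * ((unramifiedTwist F (1 / 2) : QuasiChar F).toMonoidHom)⁻¹) (η * ((unramifiedTwist F (1 / 2) : QuasiChar F).toMonoidHom)) =
      maxParabolicLeviChar F 2 η η * ((rootDeltaChar (standardParabolicGL F (lastBlockLabel 2))).comp (leviEmbeddingP F (lastBlockLabel 2)))⁻¹ := by
  refine MonoidHom.ext fun m => Units.ext ?_
  simp only [maxParabolicLeviChar_apply, MonoidHom.mul_apply, MonoidHom.inv_apply, MonoidHom.comp_apply, Units.val_mul, Units.val_inv_eq_inv_val, coe_nuHalf_apply,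
    leviProjection_leviEmbeddingP_apply, rootDeltaChar_standardParabolicGL_lastBlockLabel_rpow F (by norm_num : (1 : ℕ) ≤ 2)]
  have h2 : ((2 : ℕ) : ℝ) = (2 : ℝ) := by norm_num
  rw [h2, coe_rpow_half_mul_rpow_neg_half, mul_inv, inv_inv]
  have h0 := normAbs_cpow_half_ne_zero (Matrix.GeneralLinearGroup.det (m false))
  have h1 := normAbs_cpow_half_ne_zero (Matrix.GeneralLinearGroup.det (m true))
  field_simp

/-! ## §2 The weight of `η∘det` at `(ην½⁻¹) ⊠ (ην½)` -/

/-- **`mult₂ ρ_η ((ην½⁻¹) ⊠ (ην½)) = 1`** (★ GL2-UNL `finrank_weightSpace_twist_det_two` + §1). [cite: Zelevinsky1980, Ex. 3.2] -/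
theorem finrank_weightSpace_twist_det_two_shift :
    finrank ℂ ↥(⨅ m, Module.End.maxGenEigenspace (Representation.normalizedJacquetGL F (lastBlockLabel 2)
      ((Representation.trivial ℂ (GL (Fin 2) F) ℂ).twist (η.comp (Matrix.GeneralLinearGroup.det : GL (Fin 2) F →* Fˣ))) m)
      ((maxParabolicLeviChar F 2 (η * ((unramifiedTwist F (1 / 2) : QuasiChar F).toMonoidHom)⁻¹) (η * ((unramifiedTwist F (1 / 2) : QuasiChar F).toMonoidHom)) m : ℂˣ) : ℂ)) = 1 := by
  classical
  rw [finrank_weightSpace_twist_det_two η, if_pos (maxParabolicLeviChar_shift_eq_chi η)]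

/-- The same in the leaf's `id`-labelled currency (`tch ![ην½⁻¹, ην½]`, ★ E2-R′ relabelling). [cite: Zelevinsky1980, Ex. 3.2] -/
theorem finrank_weightSpace_twist_det_two_shift_id :
    finrank ℂ ↥(⨅ m, Module.End.maxGenEigenspace (Representation.normalizedJacquetGL F (id : Fin 2 → Fin 2)
      ((Representation.trivial ℂ (GL (Fin 2) F) ℂ).twist (η.comp (Matrix.GeneralLinearGroup.det : GL (Fin 2) F →* Fˣ))) m)
      (((∏ a : Fin 2, ((![η * ((unramifiedTwist F (1 / 2) : QuasiChar F).toMonoidHom)⁻¹, η * ((unramifiedTwist F (1 / 2) : QuasiChar F).toMonoidHom)] : Fin 2 → (Fˣ →* ℂˣ)) a).comp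
        (Matrix.GeneralLinearGroup.det.comp (Pi.evalMonoidHom (fun a : Fin 2 => GL {i : Fin 2 // (id : Fin 2 → Fin 2) i = a} F) a))) m : ℂˣ) : ℂ)) = 1 := by
  rw [finrank_weightSpace_id_eq_lastBlockLabel_two, finrank_weightSpace_twist_det_two_shift]

/-! ## §3 The embedding `η∘det ↪ I₂(ην½⁻¹, ην½)` and the degeneracy of `η∘det` -/

/-- `η ∘ det` has open kernel when `η` does. [folklore] -/
theorem isOpen_ker_comp_det_two (hη : IsOpen ((η.ker : Subgroup Fˣ) : Set Fˣ)) :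
    IsOpen (((η.comp (Matrix.GeneralLinearGroup.det : GL (Fin 2) F →* Fˣ)).ker : Subgroup (GL (Fin 2) F)) : Set (GL (Fin 2) F)) := by
  have h : (((η.comp (Matrix.GeneralLinearGroup.det : GL (Fin 2) F →* Fˣ)).ker : Subgroup (GL (Fin 2) F)) : Set (GL (Fin 2) F)) =
      (Matrix.GeneralLinearGroup.det : GL (Fin 2) F →* Fˣ) ⁻¹' ((η.ker : Subgroup Fˣ) : Set Fˣ) := by
    ext g; simp [MonoidHom.mem_ker]
  rw [h]
  exact hη.preimage Matrix.GeneralLinearGroup.continuous_det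

omit [ValuativeRel F] [TopologicalSpace F] [IsNonarchimedeanLocalField F] in
/-- `ρ_η = η ∘ det` is irreducible (one-dimensional). [folklore] -/
theorem isIrreducible_twist_det_two : ((Representation.trivial ℂ (GL (Fin 2) F) ℂ).twist (η.comp (Matrix.GeneralLinearGroup.det : GL (Fin 2) F →* Fˣ))).IsIrreducible :=
  isIrreducible_of_finrank_eq_one' _ (Module.finrank_self ℂ)

/-- **`η∘det ↪ I₂(ην½⁻¹, ην½)`**: an INJECTIVE intertwining map from the character `ρ_η` into the linked principal series (★ EMB at `N = 2` on the non-zero weight of §2, then the ★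
relabelling equivalence `I₂^{id} ≃ I₂^{lastBlockLabel}`). [cite: Zelevinsky1980, Prop. 2.10, Ex. 3.2] [cite: Bump1997, Thm. 4.5.1] [cite: BernsteinZelevinsky1977, Thm. 2.5] -/
theorem exists_injective_intertwiningMap_twist_det_principalSeries_two (hη : IsOpen ((η.ker : Subgroup Fˣ) : Set Fˣ)) :
    ∃ Φ : ((Representation.trivial ℂ (GL (Fin 2) F) ℂ).twist (η.comp (Matrix.GeneralLinearGroup.det : GL (Fin 2) F →* Fˣ))).IntertwiningMap
      (Representation.parabolicIndGL F (lastBlockLabel 2) ((Representation.trivial ℂ (Π a : Bool, GL {i : Fin 2 // lastBlockLabel 2 i = a} F) ℂ).twist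
        (maxParabolicLeviChar F 2 (η * ((unramifiedTwist F (1 / 2) : QuasiChar F).toMonoidHom)⁻¹) (η * ((unramifiedTwist F (1 / 2) : QuasiChar F).toMonoidHom))))),
      Function.Injective Φ := by
  haveI := isIrreducible_twist_det_two η
  have hsm : ((Representation.trivial ℂ (GL (Fin 2) F) ℂ).twist (η.comp (Matrix.GeneralLinearGroup.det : GL (Fin 2) F →* Fˣ))).IsSmooth :=
    isSmooth_trivial_twist (isOpen_ker_comp_det_two η hη)
  have hne : finrank ℂ ↥(⨅ m, Module.End.maxGenEigenspace (Representation.normalizedJacquetGL F (id : Fin 2 → Fin 2)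
      ((Representation.trivial ℂ (GL (Fin 2) F) ℂ).twist (η.comp (Matrix.GeneralLinearGroup.det : GL (Fin 2) F →* Fˣ))) m)
      (((∏ a : Fin 2, ((![η * ((unramifiedTwist F (1 / 2) : QuasiChar F).toMonoidHom)⁻¹, η * ((unramifiedTwist F (1 / 2) : QuasiChar F).toMonoidHom)] : Fin 2 → (Fˣ →* ℂˣ)) a).comp
        (Matrix.GeneralLinearGroup.det.comp (Pi.evalMonoidHom (fun a : Fin 2 => GL {i : Fin 2 // (id : Fin 2 → Fin 2) i = a} F) a))) m : ℂˣ) : ℂ)) ≠ 0 := by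
    rw [finrank_weightSpace_twist_det_two_shift_id]; exact one_ne_zero
  obtain ⟨Φ₀, hΦ₀⟩ := exists_injective_intertwiningMap_parabolicIndGL _ hsm _ hne
  obtain ⟨e, -⟩ := K2E3GL2BorelRelabelEquiv.exists_equiv_parabolicIndGL_id_lastBlockLabel_two (F := F)
    (η * ((unramifiedTwist F (1 / 2) : QuasiChar F).toMonoidHom)⁻¹) (η * ((unramifiedTwist F (1 / 2) : QuasiChar F).toMonoidHom))
  exact ⟨e.toIntertwiningMap.comp Φ₀, (EquivLike.injective e).comp hΦ₀⟩

omit [ValuativeRel F] [TopologicalSpace F] [IsNonarchimedeanLocalField F] in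
/-- **`η∘det` is NOT `ψ`-generic** for a non-trivial `ψ`: `U₂` acts trivially on `ℂ`, so a Whittaker functional `Λ` satisfies `Λ z = ψ_U(u) Λ z` for all `u`. [folklore] -/
theorem not_isGeneric_twist_det_two {ψ : AddChar F Circle} (hψ : ψ ≠ 0) :
    ¬ IsGeneric ((Representation.trivial ℂ (GL (Fin 2) F) ℂ).twist (η.comp (Matrix.GeneralLinearGroup.det : GL (Fin 2) F →* Fˣ))) ψ := by
  intro hg
  obtain ⟨Λ, hΛ, hΛ0⟩ := (isGeneric_iff _ _).1 hg
  obtain ⟨t, ht⟩ := AddChar.ne_zero_iff.1 hψ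
  apply hΛ0
  refine LinearMap.ext fun z => ?_
  have h := (mem_whittakerFunctionals_iff Λ).1 hΛ ⟨transvectionGL 0 1 (zero_lt_one' (Fin 2)).ne t, transvectionGL_mem_upperUnitriangular (zero_lt_one' (Fin 2)) t⟩ z
  have hdet : Matrix.GeneralLinearGroup.det (transvectionGL (0 : Fin 2) 1 (zero_lt_one' (Fin 2)).ne t : GL (Fin 2) F) = 1 :=
    Units.ext (by rw [Matrix.GeneralLinearGroup.val_det_apply, coe_transvectionGL, Matrix.det_transvection_of_ne _ _ (zero_lt_one' (Fin 2)).ne, Units.val_one])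
  have hact : ((Representation.trivial ℂ (GL (Fin 2) F) ℂ).twist (η.comp (Matrix.GeneralLinearGroup.det : GL (Fin 2) F →* Fˣ)))
      (transvectionGL (0 : Fin 2) 1 (zero_lt_one' (Fin 2)).ne t) z = z := by
    rw [Representation.twist_apply, MonoidHom.comp_apply, hdet, map_one, Units.val_one, one_smul, Representation.trivial_apply]
  have hchar : whittakerCharFun ψ ⟨transvectionGL 0 1 (zero_lt_one' (Fin 2)).ne t, transvectionGL_mem_upperUnitriangular (zero_lt_one' (Fin 2)) t⟩ = ψ t := by
    rw [← coe_whittakerChar]; exact whittakerChar_transvectionGL ψ (show ((0 : Fin 2) : ℕ) + 1 = ((1 : Fin 2) : ℕ) by decide) t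
  have h' : Λ z = ψ t * Λ z := by
    have h1 := h
    rw [hchar] at h1
    exact (congrArg Λ hact).symm.trans h1
  -- `Λ z = ψ t · Λ z` with `ψ t ≠ 1`
  have hne : ((ψ t : Circle) : ℂ) ≠ 1 := fun h1 => ht (Circle.ext (by rw [h1, Circle.coe_one]))
  have hz : (((ψ t : Circle) : ℂ) - 1) * Λ z = 0 := by rw [sub_mul, one_mul, ← h', sub_self]
  rw [LinearMap.zero_apply]
  exact (mul_eq_zero.1 hz).resolve_left (sub_ne_zero.2 hne)

omit [ValuativeRel F] [TopologicalSpace F] [IsNonarchimedeanLocalField F] in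
/-- **`J_ψ(η∘det) = 0`**: every class of the `ψ`-twisted Jacquet module of the character vanishes. [folklore] -/
theorem mk_whittakerTwist_twist_det_two_eq_zero {ψ : AddChar F Circle} (hψ : ψ ≠ 0) (z : ℂ) :
    Representation.Coinvariants.mk (whittakerTwist ((Representation.trivial ℂ (GL (Fin 2) F) ℂ).twist (η.comp (Matrix.GeneralLinearGroup.det : GL (Fin 2) F →* Fˣ))) ψ) z = 0 := by
  obtain ⟨t, ht⟩ := AddChar.ne_zero_iff.1 hψ
  have hne : ((ψ t : Circle) : ℂ) ≠ 1 := fun h1 => ht (Circle.ext (by rw [h1, Circle.coe_one]))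
  have hdet : Matrix.GeneralLinearGroup.det (transvectionGL (0 : Fin 2) 1 (zero_lt_one' (Fin 2)).ne t : GL (Fin 2) F) = 1 :=
    Units.ext (by rw [Matrix.GeneralLinearGroup.val_det_apply, coe_transvectionGL, Matrix.det_transvection_of_ne _ _ (zero_lt_one' (Fin 2)).ne, Units.val_one])
  -- `[ρ(u) z] = ψ_U(u) • [z]` and `ρ(u) z = z`
  have h := coinvariantsMk_whittakerTwist_apply ((Representation.trivial ℂ (GL (Fin 2) F) ℂ).twist (η.comp (Matrix.GeneralLinearGroup.det : GL (Fin 2) F →* Fˣ))) ψ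
    ⟨transvectionGL 0 1 (zero_lt_one' (Fin 2)).ne t, transvectionGL_mem_upperUnitriangular (zero_lt_one' (Fin 2)) t⟩ z
  have hact : ((Representation.trivial ℂ (GL (Fin 2) F) ℂ).twist (η.comp (Matrix.GeneralLinearGroup.det : GL (Fin 2) F →* Fˣ)))
      (transvectionGL (0 : Fin 2) 1 (zero_lt_one' (Fin 2)).ne t) z = z := by
    rw [Representation.twist_apply, MonoidHom.comp_apply, hdet, map_one, Units.val_one, one_smul, Representation.trivial_apply]
  have hchar : whittakerCharFun ψ ⟨transvectionGL 0 1 (zero_lt_one' (Fin 2)).ne t, transvectionGL_mem_upperUnitriangular (zero_lt_one' (Fin 2)) t⟩ = ψ t := by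
    rw [← coe_whittakerChar]; exact whittakerChar_transvectionGL ψ (show ((0 : Fin 2) : ℕ) + 1 = ((1 : Fin 2) : ℕ) by decide) t
  have h' : Representation.Coinvariants.mk (whittakerTwist ((Representation.trivial ℂ (GL (Fin 2) F) ℂ).twist (η.comp (Matrix.GeneralLinearGroup.det : GL (Fin 2) F →* Fˣ))) ψ) z =
      ((ψ t : Circle) : ℂ) • Representation.Coinvariants.mk (whittakerTwist ((Representation.trivial ℂ (GL (Fin 2) F) ℂ).twist (η.comp (Matrix.GeneralLinearGroup.det : GL (Fin 2) F →* Fˣ))) ψ) z := by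
    have h1 := h
    rw [hchar] at h1
    exact (congrArg (Representation.Coinvariants.mk _) hact).symm.trans h1
  have hz : (1 - ((ψ t : Circle) : ℂ)) • Representation.Coinvariants.mk (whittakerTwist ((Representation.trivial ℂ (GL (Fin 2) F) ℂ).twist (η.comp (Matrix.GeneralLinearGroup.det : GL (Fin 2) F →* Fˣ))) ψ) z = 0 := by
    rw [sub_smul, one_smul, ← h', sub_self]
  exact (smul_eq_zero.1 hz).resolve_left (sub_ne_zero.2 hne.symm)

end Summit.HodgeConjecture.HodgeConjecture.Cruxes.H413.K2E3GL2LinkedStructure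

end
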